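import Literature.NumberTheory.Automorphic.AsaiAtOneOfHolomorphy
import Literature.NumberTheory.Automorphic.AutomorphicRepsGLOneHeckeCharacter
import Literature.NumberTheory.Automorphic.GLnCentralCharacter
import Literature.NumberTheory.Automorphic.PairLFunctionPolesGLOneBoundaryUnconditional
import Literature.NumberTheory.Automorphic.PairLFunctionMeromorphicContinuationProofs
import Literature.NumberTheory.Automorphic.ArthurClozelCuspidalDescentAssembly
import Literature.NumberTheory.Automorphic.ClassFieldCharacterLocal
import Literature.NumberTheory.Automorphic.NormGroupClosedProofs
import Literature.NumberTheory.Automorphic.IdeleClassGroupCompactProofs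
import Literature.NumberTheory.Automorphic.IdeleNormDetGL
import Literature.NumberTheory.GaloisRepresentations.HeckeCharacterNormOneProofs
import Literature.NumberTheory.GaloisRepresentations.HeckeLFunctionNonvanishingLineProofs
import Literature.NumberTheory.LFunctions.DedekindZetaNonvanishing
import HarnessLib

/-!
# Grbac–Shahidi 2015, Thm. 4.3 at `s = 1`, in rank one: the `GL(1)` stratum of
# `GrbacShahidi2015_partialAsaiL_at_one`, proved (Hecke–Tate theory)

Topic `NumberTheory/Automorphic`; namespace `Literature.NumberTheory.Automorphic` (the Hecke-character
lemmas in `Literature.NumberTheory.GaloisRepresentations.HeckeCharacter`, for dot notation). Proof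
file (theorems only: no definition, no named fact, no instance), sibling of `AsaiSignContinuation`
(the named fact `GrbacShahidi2015_partialAsaiL_at_one`: Grbac–Shahidi, Pacific J. Math. 276 (2015),
Thm. 4.3 (1), (2)(a)–(b), rendered at `s = 1` for the partial Asai `L`-functions of a unitary
cuspidal `Π` on `GL_N(𝔸_E)`), `AsaiSignCont`, `AsaiEulerProductConvergence` and
`AsaiAtOneOfHolomorphy` (its Galois-self-dual stratum from Mok's dichotomy, its clause (i), and its
reduction to holomorphy through the Rankin–Selberg identity `(∗∗)`).

## What is proved

* `GrbacShahidi2015_partialAsaiL_at_one_rank_one` (**main**) — the fact **for `N = 1`**, verbatim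
  (every quadratic `E/F`, `c ≠ 1`, every cuspidal datum `π` of `GL₁(𝔸_E)` unitary almost
  everywhere, every Asai datum `(S, A)`, both signs), with `σ₀ = 1`.
* `GrbacShahidi2015_partialAsaiL_at_one_of_two_le` — consequently the named fact is equivalent to
  its own restriction to ranks `N ≥ 2`.

In rank one `π` acts on its line `W / W'` through a Hecke character `χ` of `E`
(`AutomorphicRepData.exists_heckeCharacter_glOne`, Gelbart §2.A; Borel–Jacquet 4.6), its Satake
parameter at an unramified `w` is `{χ(ϖ_w)}` (`AutomorphicRepData.eq_singleton_valueAtUniformizer_glOne`),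
and Grbac–Shahidi's Thm. 4.3 is Hecke's theorem (1917/1920) with Landau's non-vanishing on
`Re s = 1` — theorems of the tree (`exists_entire_forall_ne_zero_eq_partialHeckeL`,
`tprod_eulerFactor_one_eq_dedekindZetaCont_mul_prod`, `dedekindZetaCont_ne_zero_of_one_le_re_holds`,
`tendsto_sub_one_mul_dedekindZetaCont_holds`). The proof follows the printed one (pp. 204–206) in
this degenerate instance:

1. *Normalisation* (§2.A p. 190, "obtained by twisting by a unitary character"; Borel–Jacquet 5.7):
   `χ = χ₀ ‖·‖^{s₁}` with `χ₀` trivial on `A_G = ℝ_{>0}` (`HeckeCharacter.exists_eq_mul_normTwist`),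
   hence unitary (`HeckeCharacter.isUnitary_of_map_posRealIdele`: `C_E¹` is compact); unitarity of
   `π` almost everywhere gives `Re s₁ = 0`, and everything below is shifted by `τ = 2 s₁ ∈ iℝ`.
2. *`As⁺` of a character is its restriction to `𝕀_F`* (Flicker's unramified computation, pp. 305–306,
   in rank one; `eval_asaiLocalPolynomial_rankOne`): with `ψ₀ = χ₀|_{𝕀_F}`
   (`HeckeCharacter.exists_restrict`, `…valueAtUniformizer_restrict`: `ψ₀(ϖ_v) = χ₀(ϖ_w)` at an inert
   `v`, `= χ₀(ϖ_w) χ₀(ϖ_{w̄})` at a split one; the places above an Asai datum are unramified,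
   `HeightOneSpectrum.ramificationIdx_eq_one_of_asai`), `L^S(s, π, As⁺) = L_F^S(s + τ, ψ₀)` and the
   `As⁻` factor at an inert place is `(1 + ψ₀(ϖ_v) q_v^{-(s+τ)})⁻¹`.
3. *The Rankin–Selberg function of `(π, π^c)`* (identity `(∗∗)` p. 205): with `Θ = χ₀ · (χ₀ ∘ c)`
   (`HeckeCharacter.exists_galConj`), `L^{S_E}(s, A ⊗ A^c) = L_E^{S_E}(s + τ, Θ)`
   (`eval_satakePairPolynomial_rankOne`), and `ψ₀ = 1 ⇒ Θ = χ₀ ∘ N_{E/F} = 1`.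
4. *Continuation* (`exists_continuation_partialHeckeL_shift`): a shifted partial Hecke `L`-function
   `L^T(s + τ, ψ)` of a unitary `ψ` trivial on `A_G` is, near `{Re s ≥ 1}`, `(s - 1)^{-k} G(s)` with `G`
   holomorphic on `{1 < Re s} ∪ B(1, δ)`, `G(1) ≠ 0`, `k = 1` iff `ψ = 1` and `τ = 0`.
5. *Order count* (p. 206): `As⁺` directly; `As⁻ = L^{S_E}(π × π^c) / As⁺` by Mok's factorisation
   (`IsAsaiDatum.partialPairL_smul_eq_partialAsaiL_mul`) and the non-vanishing of `L_F^S(s + τ, ψ₀)`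
   on `{1 < Re s} ∪ B(1, δ)` (Euler product, and `G(1) ≠ 0` with continuity), with
   `k₋ = k_R - k₊ ∈ {0, 1}` by step 3.

## References

* N. Grbac, F. Shahidi, *Endoscopic transfer for unitary groups and holomorphy of Asai
  `L`-functions*, Pacific J. Math. 276 (2015), 185–211: Thm. 4.3 (pp. 186, 204), §2.A (p. 190), proof
  pp. 204–206. [GrbacShahidi2015]
* Y. Z. Flicker, *Twisted tensors and Euler products*, Bull. Soc. Math. France 116 (1988), 295–313,
  pp. 305–306. [Flicker1988]
* J. Tate, *Fourier analysis in number fields and Hecke's zeta-functions*, in Cassels–Fröhlich,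
  *Algebraic Number Theory* (1967), Ch. XV, §4.3 and Thm. 4.4.1; Ch. II §16, Ch. VII §1.1 of the same
  volume. [TateThesis1967] [CasselsFrohlichANT1967]
* K. Iwasawa, *Hecke's `L`-functions* (Princeton lectures 1964), SpringerBriefs (2019), Thm. 3.1,
  Prop. 4.4. [Iwasawa2019]
* E. Landau, *Neuer Beweis des Primzahlsatzes und Beweis des Primidealsatzes*, Math. Ann. 56 (1903).
  [LandauMathAnn1903]
* A. Borel, H. Jacquet, *Automorphic forms and automorphic representations*, Corvallis (1979), 4.6,
  5.7. [BorelJacquet1979]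
* J. Neukirch, *Algebraic Number Theory* (1999), Ch. I (9.2), Ch. VII (5.11), (8.1). [NeukirchANT1999]
-/

noncomputable section

open scoped Topology NNReal Classical
open NumberField IsDedekindDomain Filter

namespace Literature.NumberTheory.Automorphic

open Literature.NumberTheory.GaloisRepresentations

/-! ### Hecke characters trivial on `A_G = ℝ_{>0}` are unitary -/

section Unitary

variable {K : Type} [Field K] [NumberField K]

/-- **A Hecke character trivial on the positive real ideles is unitary**: `𝕀_K = 𝕀_K¹ · ℝ_{>0}`
(Weil, Ch. IV §4, Cor. 2 of Thm. 5) and `C_K¹ = 𝕀_K¹ / Kˣ` is compact (Cassels–Fröhlich, Ch. II §16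
Theorem), so `|χ|` is a bounded — hence trivial — character of `𝕀_K¹`.
[cite: CasselsFrohlichANT1967, Ch. II §16 Theorem] -/
theorem _root_.Literature.NumberTheory.GaloisRepresentations.HeckeCharacter.isUnitary_of_map_posRealIdele {χ : HeckeCharacter K}
    (hA : ∀ r : ℝ≥0ˣ, χ (posRealIdele K r) = 1) : χ.IsUnitary := by
  -- `c ↦ |χ(c)|` on `C_K`, continuous, bounded on the compact `C_K¹`
  set f : IdeleClassGroup K → ℝ := fun c => ‖((χ.toIdeleClassCharacter c : ℂˣ) : ℂ)‖ with hf
  have hfc : Continuous f :=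
    continuous_norm.comp (Units.continuous_val.comp χ.toIdeleClassCharacter.continuous)
  obtain ⟨M, hM⟩ := ((IdeleClassGroup.isCompact_normOne_holds K).image hfc).isBounded.bddAbove
  have hbound : ∀ y ∈ normOneIdeles K, ‖((χ y : ℂˣ) : ℂ)‖ ≤ M := fun y hy =>
    hM ⟨(y : IdeleClassGroup K), ⟨y, hy, rfl⟩, rfl⟩
  -- `|χ(y)| ≤ 1` on `𝕀¹` (powers stay in `𝕀¹` and are bounded)
  have hle : ∀ y ∈ normOneIdeles K, ‖((χ y : ℂˣ) : ℂ)‖ ≤ 1 := by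
    intro y hy
    by_contra hlt
    push Not at hlt
    obtain ⟨n, hn⟩ := pow_unbounded_of_one_lt M hlt
    have h := hbound (y ^ n) (pow_mem hy n)
    rw [map_pow, Units.val_pow_eq_pow_val, norm_pow] at h
    exact absurd (lt_of_lt_of_le hn h) (lt_irrefl _)
  -- hence `|χ(y)| = 1` on `𝕀¹` (apply the bound to `y⁻¹`)
  have heq : ∀ y ∈ normOneIdeles K, ‖((χ y : ℂˣ) : ℂ)‖ = 1 := by
    intro y hy
    refine le_antisymm (hle y hy) ?_
    have h1 := hle y⁻¹ (inv_mem hy)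
    rw [map_inv, Units.val_inv_eq_inv_val, norm_inv] at h1
    have hpos : 0 < ‖((χ y : ℂˣ) : ℂ)‖ := norm_pos_iff.mpr (χ y).ne_zero
    rwa [inv_le_one₀ hpos] at h1
  intro x
  obtain ⟨y, hy, r, rfl⟩ := exists_normOneIdeles_mul_posRealIdele K x
  rw [map_mul, hA r, mul_one]
  exact heq y hy

end Unitary

/-! ### Restriction of Hecke characters along `𝕀_F → 𝕀_E` and Galois conjugation -/

section RestrictConj

variable {F E : Type} [Field F] [NumberField F] [Field E] [NumberField E] [Algebra F E]

variable (F) in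
/-- **Restriction of a Hecke character along `𝕀_F → 𝕀_E`**: for a Hecke character `χ` of `E`
there is a Hecke character `χ|_F` of `F` with `χ|_F(x) = χ(x_E)` (`x_E` the base change of the idele
`x`; continuity `continuous_ideleBaseChange`, principal ideles to principal ideles
`ideleBaseChange_mem_principalIdeles`). (Cassels–Fröhlich, Ch. II §14; Neukirch, Ch. VI §1–2.)
[folklore] -/
theorem _root_.Literature.NumberTheory.GaloisRepresentations.HeckeCharacter.exists_restrict (χ : HeckeCharacter E) :
    ∃ χ₀ : HeckeCharacter F, ∀ x, χ₀ x = χ (AdeleRing.ideleBaseChange F E x) :=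
  ⟨{ toContinuousMonoidHom :=
      { toMonoidHom := χ.toContinuousMonoidHom.toMonoidHom.comp (AdeleRing.ideleBaseChange F E)
        continuous_toFun := (map_continuous χ).comp (continuous_ideleBaseChange F E) }
     map_principal' := fun _ hx => χ.map_principal (ideleBaseChange_mem_principalIdeles F E hx) },
    fun _ => rfl⟩

omit [NumberField F] in
/-- **The Galois conjugate `χ ∘ σ` of a Hecke character** of `E` by `σ ∈ Aut(E/F)`: the idele
action is a continuous group automorphism (`ideleGroup_continuous_smul`) preserving the principal
ideles (`smul_mem_principalIdeles`). (Cassels–Fröhlich, Ch. VII §1.1.) [folklore] -/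
theorem _root_.Literature.NumberTheory.GaloisRepresentations.HeckeCharacter.exists_galConj (χ : HeckeCharacter E) (σ : E ≃ₐ[F] E) :
    ∃ χ' : HeckeCharacter E, ∀ x, χ' x = χ (σ • x) :=
  ⟨{ toContinuousMonoidHom :=
      { toMonoidHom := χ.toContinuousMonoidHom.toMonoidHom.comp
          (MulDistribMulAction.toMonoidHom (ideleGroup E) σ)
        continuous_toFun := (map_continuous χ).comp (ideleGroup_continuous_smul F E σ) }
     map_principal' := fun _ hx => χ.map_principal (smul_mem_principalIdeles F E σ hx) },
    fun _ => rfl⟩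

/-- The local component of the restriction: `(χ|_F)_v(u) = ∏_{w ∈ T} χ_w(u)` for any finset `T`
listing the places of `E` above `v`, `u ∈ F_vˣ` viewed in each `E_w` (`ideleBaseChange_localUnits`).
[folklore] -/
theorem _root_.Literature.NumberTheory.GaloisRepresentations.HeckeCharacter.localComponent_restrict {χ : HeckeCharacter E} {χ₀ : HeckeCharacter F}
    (h : ∀ x, χ₀ x = χ (AdeleRing.ideleBaseChange F E x)) (v : HeightOneSpectrum (𝓞 F))
    (u : (v.adicCompletion F)ˣ) (c : ∀ w : HeightOneSpectrum (𝓞 E), (w.adicCompletion E)ˣ)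
    (hc : ∀ (w : HeightOneSpectrum (𝓞 E)) (_ : w.under (𝓞 F) = v) [w.asIdeal.LiesOver v.asIdeal],
      (c w : w.adicCompletion E) = adicCompletionOfLiesOver F E v w (u : v.adicCompletion F))
    (T : Finset (HeightOneSpectrum (𝓞 E))) (hT : ∀ w, w ∈ T ↔ w.under (𝓞 F) = v) :
    χ₀.localComponent v u = ∏ w ∈ T, χ.localComponent w (c w) := by
  rw [HeckeCharacter.localComponent_apply, h, ideleBaseChange_localUnits E v u c hc T hT, map_prod]
  rfl

/-- A local element of valuation one gives a unit of `𝒪_w`, and a Hecke character unramified at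
`w` is trivial on it. [folklore] -/
theorem _root_.Literature.NumberTheory.GaloisRepresentations.HeckeCharacter.localComponent_eq_one_of_valued_eq_one {ω : HeckeCharacter E}
    {w : HeightOneSpectrum (𝓞 E)} (hω : ω.IsUnramifiedAt w) {d : (w.adicCompletion E)ˣ}
    (hd : Valued.v (d : w.adicCompletion E) = 1) : ω.localComponent w d = 1 := by
  let d₀ : (w.adicCompletionIntegers E)ˣ :=
    ⟨⟨d, (HeightOneSpectrum.mem_adicCompletionIntegers (R := 𝓞 E) E w).mpr hd.le⟩,
      ⟨(((d⁻¹ : (w.adicCompletion E)ˣ)) : w.adicCompletion E),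
        (HeightOneSpectrum.mem_adicCompletionIntegers (R := 𝓞 E) E w).mpr (by
          rw [Units.val_inv_eq_inv_val, map_inv₀, hd, inv_one])⟩,
      Subtype.ext d.mul_inv, Subtype.ext d.inv_mul⟩
  have hd₀ : Units.map ((w.adicCompletionIntegers E).subtype : _ →* _) d₀ = d := Units.ext rfl
  rw [← hd₀]
  exact hω d₀

/-- **The restriction is unramified below unramified places**: if `χ` is unramified at every place
of `E` above `v`, then `χ|_F` is unramified at `v`. [folklore] -/
theorem _root_.Literature.NumberTheory.GaloisRepresentations.HeckeCharacter.isUnramifiedAt_restrict {χ : HeckeCharacter E} {χ₀ : HeckeCharacter F}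
    (h : ∀ x, χ₀ x = χ (AdeleRing.ideleBaseChange F E x)) {v : HeightOneSpectrum (𝓞 F)}
    (T : Finset (HeightOneSpectrum (𝓞 E))) (hT : ∀ w, w ∈ T ↔ w.under (𝓞 F) = v)
    (hv : ∀ w : HeightOneSpectrum (𝓞 E), w.under (𝓞 F) = v → χ.IsUnramifiedAt w) :
    χ₀.IsUnramifiedAt v := by
  intro u
  obtain ⟨c, hc, -⟩ := exists_localUnitsAbove (F := F) E v
    (Units.map ((v.adicCompletionIntegers F).subtype : _ →* _) u)
  rw [HeckeCharacter.localComponent_restrict h v _ c hc T hT]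
  refine Finset.prod_eq_one fun w hw => ?_
  have hwv : w.under (𝓞 F) = v := (hT w).1 hw
  haveI : w.asIdeal.LiesOver v.asIdeal := ⟨(congrArg HeightOneSpectrum.asIdeal hwv).symm⟩
  refine HeckeCharacter.localComponent_eq_one_of_valued_eq_one (hv w hwv) ?_
  rw [hc w hwv, valued_adicCompletionOfLiesOver]
  have hu : Valued.v (((Units.map ((v.adicCompletionIntegers F).subtype : _ →* _) u :
      (v.adicCompletion F)ˣ) : v.adicCompletion F)) = 1 := by
    change Valued.v ((u : v.adicCompletionIntegers F) : v.adicCompletion F) = 1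
    exact Valuation.Integers.one_of_isUnit (Valuation.integer.integers _) u.isUnit
  rw [hu, one_pow]

/-- **The value of the restriction at a uniformizer over a place unramified in `E`**: if every
`w ∈ T` (the places above `v`) has `e(w|v) = 1` and `χ` is unramified above `v`, then
`χ|_F(ϖ_v) = ∏_{w ∈ T} χ(ϖ_w)` (a uniformizer of `F_v` stays one in each `E_w`). [folklore] -/
theorem _root_.Literature.NumberTheory.GaloisRepresentations.HeckeCharacter.valueAtUniformizer_restrict {χ : HeckeCharacter E} {χ₀ : HeckeCharacter F}
    (h : ∀ x, χ₀ x = χ (AdeleRing.ideleBaseChange F E x)) {v : HeightOneSpectrum (𝓞 F)}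
    (T : Finset (HeightOneSpectrum (𝓞 E))) (hT : ∀ w, w ∈ T ↔ w.under (𝓞 F) = v)
    (he : ∀ w : HeightOneSpectrum (𝓞 E), w.under (𝓞 F) = v → w.asIdeal.ramificationIdx (𝓞 F) = 1)
    (hv : ∀ w : HeightOneSpectrum (𝓞 E), w.under (𝓞 F) = v → χ.IsUnramifiedAt w) :
    χ₀.valueAtUniformizer v = ∏ w ∈ T, χ.valueAtUniformizer w := by
  obtain ⟨c, hc, -⟩ := exists_localUnitsAbove (F := F) E v (HeckeCharacter.uniformizer F v)
  unfold HeckeCharacter.valueAtUniformizer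
  rw [HeckeCharacter.localComponent_restrict h v _ c hc T hT, Units.coe_prod]
  refine Finset.prod_congr rfl fun w hw => ?_
  have hwv : w.under (𝓞 F) = v := (hT w).1 hw
  haveI : w.asIdeal.LiesOver v.asIdeal := ⟨(congrArg HeightOneSpectrum.asIdeal hwv).symm⟩
  refine HeckeCharacter.localComponent_eq_valueAtUniformizer (hv w hwv) ?_
  rw [hc w hwv, valued_adicCompletionOfLiesOver, HeckeCharacter.valued_uniformizer,
    Ideal.ramificationIdx'_eq_ramificationIdx v.asIdeal w.asIdeal v.ne_bot, he w hwv, pow_one]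

omit [NumberField F] in
/-- **The Galois conjugate is unramified at `w` when `χ` is unramified at `σ • w`**
(`σ • ⟨u⟩_w = ⟨σ u⟩_{σ w}` with `σ u` again a local unit, `smul_localUnits`,
`valued_galAdicCompletionUnitsEquiv`). [cite: CasselsFrohlichANT1967, Ch. VII §1.1] -/
theorem _root_.Literature.NumberTheory.GaloisRepresentations.HeckeCharacter.isUnramifiedAt_galConj {χ χ' : HeckeCharacter E} {σ : E ≃ₐ[F] E}
    (h : ∀ x, χ' x = χ (σ • x)) {w : HeightOneSpectrum (𝓞 E)} (hw : χ.IsUnramifiedAt (σ • w)) :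
    χ'.IsUnramifiedAt w := by
  intro u
  rw [HeckeCharacter.localComponent_apply, h, smul_localUnits F E σ w,
    ← HeckeCharacter.localComponent_apply]
  refine HeckeCharacter.localComponent_eq_one_of_valued_eq_one hw ?_
  rw [valued_galAdicCompletionUnitsEquiv]
  change Valued.v ((u : w.adicCompletionIntegers E) : w.adicCompletion E) = 1
  exact Valuation.Integers.one_of_isUnit (Valuation.integer.integers _) u.isUnit

omit [NumberField F] in
/-- **The Galois conjugate at a uniformizer**: `(χ ∘ σ)(ϖ_w) = χ(ϖ_{σ w})` when `χ` is unramified at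
`σ • w` (`σ` moves uniformizer ideles to uniformizer ideles). [cite: CasselsFrohlichANT1967, Ch. VII §1.1] -/
theorem _root_.Literature.NumberTheory.GaloisRepresentations.HeckeCharacter.valueAtUniformizer_galConj {χ χ' : HeckeCharacter E} {σ : E ≃ₐ[F] E}
    (h : ∀ x, χ' x = χ (σ • x)) {w : HeightOneSpectrum (𝓞 E)} (hw : χ.IsUnramifiedAt (σ • w)) :
    χ'.valueAtUniformizer w = χ.valueAtUniformizer (σ • w) := by
  unfold HeckeCharacter.valueAtUniformizer
  rw [HeckeCharacter.localComponent_apply, h, smul_localUnits F E σ w,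
    ← HeckeCharacter.localComponent_apply]
  refine HeckeCharacter.localComponent_eq_valueAtUniformizer hw ?_
  rw [valued_galAdicCompletionUnitsEquiv, HeckeCharacter.valued_uniformizer]

end RestrictConj


/-! ### Places of a quadratic extension: ramification above an Asai datum -/

section Quadratic

variable {F E : Type} [Field F] [NumberField F] [Field E] [NumberField E] [Algebra F E]

/-- In a quadratic extension, a place of residue degree `2` is unramified with a single place
above the one below: `e = 1`, `f = 2` (`g e f = 2`, Neukirch, Ch. I, (9.2)). [folklore] -/
theorem HeightOneSpectrum.ramificationIdxIn_eq_one_of_inertiaDeg_eq_two (h2 : Module.finrank F E = 2)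
    {w : HeightOneSpectrum (𝓞 E)} (hf : w.asIdeal.inertiaDeg (𝓞 F) = 2) :
    (w.under (𝓞 F)).asIdeal.ramificationIdxIn (𝓞 E) = 1 ∧
      (w.under (𝓞 F)).asIdeal.inertiaDegIn (𝓞 E) = 2 := by
  haveI : Algebra.IsQuadraticExtension F E := { finrank_eq_two' := h2 }
  have hfIn : (w.under (𝓞 F)).asIdeal.inertiaDegIn (𝓞 E) = 2 := by
    rw [← inertiaDeg_eq_inertiaDegIn_under w, hf]
  refine ⟨?_, hfIn⟩
  have hprod := Ideal.ncard_primesOver_mul_ramificationIdxIn_mul_inertiaDegIn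
    (w.under (𝓞 F)).asIdeal (𝓞 E) (E ≃ₐ[F] E)
  rw [IsGaloisGroup.card_eq_finrank (E ≃ₐ[F] E) F E, h2, ← card_placesOver, hfIn] at hprod
  haveI := finite_placesOver (E := E) (w.under (𝓞 F))
  set n := Nat.card {w' : HeightOneSpectrum (𝓞 E) // w'.under (𝓞 F) = w.under (𝓞 F)}
  set e := (w.under (𝓞 F)).asIdeal.ramificationIdxIn (𝓞 E)
  have hne : n * e = 1 := Nat.eq_of_mul_eq_mul_right two_pos (by rw [mul_assoc, one_mul]; exact hprod)
  exact Nat.eq_one_of_mul_eq_one_left hne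

/-- In a quadratic extension, a place moved by the non-trivial automorphism is unramified of
residue degree one: `e = f = 1` (two places above, `g e f = 2`). [folklore] -/
theorem HeightOneSpectrum.ramificationIdxIn_eq_one_of_smul_ne (h2 : Module.finrank F E = 2)
    {c : E ≃ₐ[F] E} {w : HeightOneSpectrum (𝓞 E)} (hw : c • w ≠ w) :
    (w.under (𝓞 F)).asIdeal.ramificationIdxIn (𝓞 E) = 1 ∧
      (w.under (𝓞 F)).asIdeal.inertiaDegIn (𝓞 E) = 1 := by
  haveI : Algebra.IsQuadraticExtension F E := { finrank_eq_two' := h2 }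
  have hprod := Ideal.ncard_primesOver_mul_ramificationIdxIn_mul_inertiaDegIn
    (w.under (𝓞 F)).asIdeal (𝓞 E) (E ≃ₐ[F] E)
  rw [IsGaloisGroup.card_eq_finrank (E ≃ₐ[F] E) F E, h2, ← card_placesOver] at hprod
  haveI := finite_placesOver (E := E) (w.under (𝓞 F))
  have hcard : 1 < Nat.card {w' : HeightOneSpectrum (𝓞 E) // w'.under (𝓞 F) = w.under (𝓞 F)} :=
    Finite.one_lt_card_iff_nontrivial.mpr
      ⟨⟨⟨w, rfl⟩, ⟨c • w, HeightOneSpectrum.under_algEquiv_smul F E c w⟩,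
        fun h => hw.symm (congrArg Subtype.val h)⟩⟩
  set n := Nat.card {w' : HeightOneSpectrum (𝓞 E) // w'.under (𝓞 F) = w.under (𝓞 F)}
  set m := (w.under (𝓞 F)).asIdeal.ramificationIdxIn (𝓞 E) *
    (w.under (𝓞 F)).asIdeal.inertiaDegIn (𝓞 E)
  have hm : m ≠ 0 := fun h => by rw [h, mul_zero] at hprod; exact absurd hprod (by norm_num)
  have hm1 : m = 1 := by
    have hm1 : m ≤ 1 := by
      by_contra h
      have : 2 * 2 ≤ n * m := Nat.mul_le_mul hcard (by omega)
      omega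
    omega
  exact ⟨Nat.eq_one_of_mul_eq_one_right hm1, Nat.eq_one_of_mul_eq_one_left hm1⟩

/-- In a Galois extension `e(w|v)` is the common ramification index `e_v`
(Mathlib `Ideal.ramificationIdxIn_eq_ramificationIdx`). [folklore] -/
theorem HeightOneSpectrum.ramificationIdx_eq_ramificationIdxIn_under [IsGalois F E]
    (w : HeightOneSpectrum (𝓞 E)) :
    w.asIdeal.ramificationIdx (𝓞 F) = (w.under (𝓞 F)).asIdeal.ramificationIdxIn (𝓞 E) := by
  haveI : w.asIdeal.LiesOver (w.under (𝓞 F)).asIdeal := ⟨rfl⟩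
  exact (Ideal.ramificationIdxIn_eq_ramificationIdx (w.under (𝓞 F)).asIdeal w.asIdeal (E ≃ₐ[F] E)).symm

/-- **Above an Asai datum every place is unramified**: if the `c`-fixed places above `v` have
residue degree `2`, then `e(w|v) = 1` for every `w ∣ v` (quadratic `E/F`, `c ≠ 1`). [folklore] -/
theorem HeightOneSpectrum.ramificationIdx_eq_one_of_asai (h2 : Module.finrank F E = 2)
    {c : E ≃ₐ[F] E} {w : HeightOneSpectrum (𝓞 E)}
    (hinert : c • w = w → w.asIdeal.inertiaDeg (𝓞 F) = 2) : w.asIdeal.ramificationIdx (𝓞 F) = 1 := by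
  haveI : Algebra.IsQuadraticExtension F E := { finrank_eq_two' := h2 }
  rw [HeightOneSpectrum.ramificationIdx_eq_ramificationIdxIn_under]
  by_cases hcw : c • w = w
  · exact (HeightOneSpectrum.ramificationIdxIn_eq_one_of_inertiaDeg_eq_two h2 (hinert hcw)).1
  · exact (HeightOneSpectrum.ramificationIdxIn_eq_one_of_smul_ne h2 hcw).1

/-- The places above `v` in a quadratic extension: `{w_v, c • w_v}` (`w_v = placeAbove E v`).
[folklore] -/
theorem HeightOneSpectrum.mem_pair_placeAbove_iff (h2 : Module.finrank F E = 2) {c : E ≃ₐ[F] E}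
    (hc : c ≠ 1) (v : HeightOneSpectrum (𝓞 F)) (w : HeightOneSpectrum (𝓞 E)) :
    w ∈ ({placeAbove E v, c • placeAbove E v} : Finset (HeightOneSpectrum (𝓞 E))) ↔
      w.under (𝓞 F) = v := by
  classical
  simp only [Finset.mem_insert, Finset.mem_singleton]
  constructor
  · rintro (rfl | rfl)
    · exact placeAbove_under v
    · rw [HeightOneSpectrum.under_algEquiv_smul F E c, placeAbove_under]
  · intro hw
    rcases HeightOneSpectrum.eq_or_eq_smul_of_under_eq h2 hc (hw.trans (placeAbove_under v).symm)
      with h | h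
    · exact Or.inl h
    · exact Or.inr h

end Quadratic


/-! ### The unramified Asai and Rankin–Selberg factors of a Hecke character of `E` -/

section LocalFactors

variable {F E : Type} [Field F] [NumberField F] [Field E] [NumberField E] [Algebra F E]

/-- `‖·‖^{s₁}` at a uniformizer: `q_w^{-s₁}`. [folklore] -/
theorem _root_.Literature.NumberTheory.GaloisRepresentations.HeckeCharacter.valueAtUniformizer_normTwist {ν : HeckeCharacter E} {s₁ : ℂ}
    (hν : ∀ x : ideleGroup E, ((ν x : ℂˣ) : ℂ) = ((ideleNorm x : ℝ) : ℂ) ^ s₁)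
    (w : HeightOneSpectrum (𝓞 E)) : ν.valueAtUniformizer w = ((w.residueCard : ℂ)) ^ (-s₁) :=
  HeckeCharacter.valueAtUniformizer_of_forall_apply_eq_cpow hν w

/-- **The Asai factor of a Hecke character of `E` at a place above an Asai datum.** Let
`χ = χ₀ ‖·‖^{s₁}` be a Hecke character of `E`, `ψ₀ = χ₀|_{𝕀_F}`, `v` a finite place of `F` above
which `χ₀` is unramified and the `c`-fixed places have residue degree `2`, and `A` the family of
singletons `{χ(ϖ_w)}` above `v`. Then, in `T = q_v^{-s}`,
`det(1 - As^η(t_v) T) = 1 - ε · ψ₀(ϖ_v) · q_v^{-2 s₁} · T` with `ε = η` at an inert `v` and `ε = 1`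
at a split one: the rank-one case of Flicker's unramified computation (`As⁺` of a character is its
restriction to `𝕀_F`, `As⁻` the `ω_{E/F}`-twist). [cite: Flicker1988, pp. 305–306] -/
theorem eval_asaiLocalPolynomial_rankOne (h2 : Module.finrank F E = 2) {c : E ≃ₐ[F] E} (hc : c ≠ 1)
    {χ χ₀ ν : HeckeCharacter E} {s₁ : ℂ}
    (hν : ∀ x : ideleGroup E, ((ν x : ℂˣ) : ℂ) = ((ideleNorm x : ℝ) : ℂ) ^ s₁) (hχ : χ = χ₀ * ν)
    {ψ₀ : HeckeCharacter F} (hψ₀ : ∀ x, ψ₀ x = χ₀ (AdeleRing.ideleBaseChange F E x))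
    {A : SatakeFamily E} {v : HeightOneSpectrum (𝓞 F)}
    (hA : ∀ w : HeightOneSpectrum (𝓞 E), w.under (𝓞 F) = v → A w = {χ.valueAtUniformizer w})
    (hunr : ∀ w : HeightOneSpectrum (𝓞 E), w.under (𝓞 F) = v → χ₀.IsUnramifiedAt w)
    (hinert : ∀ w : HeightOneSpectrum (𝓞 E), w.under (𝓞 F) = v → c • w = w →
      w.asIdeal.inertiaDeg (𝓞 F) = 2)
    (η : ℤˣ) (x : ℂ) :
    (asaiLocalPolynomial c A η (placeAbove E v)).eval x =
      1 - (if c • placeAbove E v = placeAbove E v then (((η : ℤ) : ℂ)) else 1) *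
        ψ₀.valueAtUniformizer v * ((v.residueCard : ℂ) ^ (-(2 * s₁))) * x := by
  haveI : Algebra.IsQuadraticExtension F E := { finrank_eq_two' := h2 }
  set w₀ := placeAbove E v with hw₀
  have hw₀v : w₀.under (𝓞 F) = v := placeAbove_under v
  have hq0 : (v.residueCard : ℂ) ≠ 0 :=
    Nat.cast_ne_zero.mpr (ne_of_gt (lt_trans zero_lt_one v.one_lt_residueCard))
  -- `χ(ϖ_w) = χ₀(ϖ_w) q_w^{-s₁}`
  have hχw : ∀ w : HeightOneSpectrum (𝓞 E), χ.valueAtUniformizer w =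
      χ₀.valueAtUniformizer w * ((w.residueCard : ℂ)) ^ (-s₁) := fun w => by
    rw [hχ, HeckeCharacter.valueAtUniformizer_mul, HeckeCharacter.valueAtUniformizer_normTwist hν]
  -- the restriction at `ϖ_v`
  have he : ∀ w : HeightOneSpectrum (𝓞 E), w.under (𝓞 F) = v → w.asIdeal.ramificationIdx (𝓞 F) = 1 :=
    fun w hw => HeightOneSpectrum.ramificationIdx_eq_one_of_asai h2 (hinert w hw)
  have hψv := HeckeCharacter.valueAtUniformizer_restrict hψ₀ _
    (HeightOneSpectrum.mem_pair_placeAbove_iff h2 hc v) he hunr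
  by_cases hfix : c • w₀ = w₀
  · -- inert: `q_{w₀} = q_v²`, one place above `v`
    rw [if_pos hfix, asaiLocalPolynomial_of_smul_eq A η hfix, hA w₀ hw₀v,
      asaiInertPolynomial_singleton]
    simp only [Polynomial.eval_sub, Polynomial.eval_one, Polynomial.eval_mul, Polynomial.eval_C,
      Polynomial.eval_X]
    rw [← hw₀, hfix, Finset.insert_eq_of_mem (Finset.mem_singleton_self _), Finset.prod_singleton] at hψv
    have hq : (w₀.residueCard : ℂ) = (v.residueCard : ℂ) ^ (2 : ℕ) := by
      rw [residueCard_eq_pow_inertiaDeg (F := F) w₀, hinert w₀ hw₀v hfix, hw₀v, Nat.cast_pow]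
    rw [hχw w₀, hψv, hq, ← Complex.natCast_cpow_natCast_mul]
    congr 1
    rw [show ((2 : ℕ) : ℂ) * -s₁ = -(2 * s₁) by push_cast; ring]
    ring
  · -- split: `q_{w₀} = q_{c • w₀} = q_v`, two places above `v`
    have hne : w₀ ≠ c • w₀ := fun h => hfix h.symm
    rw [if_neg hfix, asaiLocalPolynomial_of_smul_ne A η hfix, hA w₀ hw₀v,
      hA (c • w₀) ((HeightOneSpectrum.under_algEquiv_smul F E c w₀).trans hw₀v),
      eval_satakePairPolynomial_singleton, ← hw₀, Finset.prod_pair hne] at *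
    rw [hψv, hχw w₀, hχw (c • w₀), residueCard_smul F c w₀]
    have hq : (w₀.residueCard : ℂ) = (v.residueCard : ℂ) := by
      rw [residueCard_eq_pow_inertiaDeg (F := F) w₀,
        HeightOneSpectrum.inertiaDeg_eq_one_of_smul_ne h2 hfix, pow_one, hw₀v]
    rw [hq, show -(2 * s₁) = -s₁ + -s₁ by ring, Complex.cpow_add _ _ hq0]
    ring

omit [NumberField F] in
/-- **The Rankin–Selberg factor of `(χ, χ ∘ c)` at a place of `E`**: with `Θ = χ₀ · (χ₀ ∘ c)` and
`A w = {χ(ϖ_w)}`, `A (c • w) = {χ(ϖ_{c • w})}`, `χ = χ₀ ‖·‖^{s₁}` unramified at `w` and `c • w`: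
`det(1 - t_w ⊗ t_{c • w} T) = 1 - Θ(ϖ_w) q_w^{-2 s₁} T`. [folklore] -/
theorem eval_satakePairPolynomial_rankOne [IsGalois F E] {c : E ≃ₐ[F] E}
    {χ χ₀ ν χ₀c : HeckeCharacter E} {s₁ : ℂ}
    (hν : ∀ x : ideleGroup E, ((ν x : ℂˣ) : ℂ) = ((ideleNorm x : ℝ) : ℂ) ^ s₁) (hχ : χ = χ₀ * ν)
    (hχ₀c : ∀ x, χ₀c x = χ₀ (c • x)) {A : SatakeFamily E} {w : HeightOneSpectrum (𝓞 E)}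
    (hAw : A w = {χ.valueAtUniformizer w}) (hAcw : A (c • w) = {χ.valueAtUniformizer (c • w)})
    (hunr : χ₀.IsUnramifiedAt (c • w)) (x : ℂ) :
    (satakePairPolynomial (A w) (A (c • w))).eval x =
      1 - (χ₀ * χ₀c).valueAtUniformizer w * ((w.residueCard : ℂ) ^ (-(2 * s₁))) * x := by
  have hq0 : (w.residueCard : ℂ) ≠ 0 :=
    Nat.cast_ne_zero.mpr (ne_of_gt (lt_trans zero_lt_one w.one_lt_residueCard))
  rw [hAw, hAcw, eval_satakePairPolynomial_singleton, HeckeCharacter.valueAtUniformizer_mul,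
    HeckeCharacter.valueAtUniformizer_galConj hχ₀c hunr, hχ, HeckeCharacter.valueAtUniformizer_mul,
    HeckeCharacter.valueAtUniformizer_mul, HeckeCharacter.valueAtUniformizer_normTwist hν,
    HeckeCharacter.valueAtUniformizer_normTwist hν, residueCard_smul F c w,
    show -(2 * s₁) = -s₁ + -s₁ by ring, Complex.cpow_add _ _ hq0]
  ring

end LocalFactors


/-! ### Partial Euler products of unitary Hecke characters: convergence, non-vanishing, continuation -/

section HeckeAnalytic

variable {K : Type} [Field K] [NumberField K]

/-- `1(ϖ_v) = 1` (a copy of `HeckeCharacter.valueAtUniformizer_one`, not imported here). [folklore] -/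
private theorem valueAtUniformizer_one_rankOne (v : HeightOneSpectrum (𝓞 K)) :
    (1 : HeckeCharacter K).valueAtUniformizer v = 1 := by
  rw [HeckeCharacter.valueAtUniformizer, HeckeCharacter.localComponent_apply,
    HeckeCharacter.one_apply, Units.val_one]

/-- For unitary `ψ`, `‖ε_v‖ ≤ 1` and `Re s > 1`, the data `ε_v ψ(ϖ_v) q_v^{-s}` are absolutely
summable over any set of places (`∑_v q_v^{-σ} < ∞`, Neukirch VII (8.1)).
[cite: NeukirchANT1999, Ch. VII Prop. (8.1)] -/
theorem summable_norm_twistedEulerDatum {ψ : HeckeCharacter K} (hu : ψ.IsUnitary)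
    (S : Set (HeightOneSpectrum (𝓞 K))) {ε : HeightOneSpectrum (𝓞 K) → ℂ} (hε : ∀ v, ‖ε v‖ ≤ 1)
    {s : ℂ} (hs : 1 < s.re) :
    Summable fun v : {v : HeightOneSpectrum (𝓞 K) // v ∉ S} =>
      ‖ε v.1 * ψ.valueAtUniformizer v.1 * ((v.1.residueCard : ℂ) ^ (-s))‖ := by
  have h := (summable_residueCard_rpow_neg (K := K) hs).subtype {v | v ∉ S}
  refine Summable.of_nonneg_of_le (fun _ => norm_nonneg _) (fun v => ?_) h
  rw [Function.comp_apply, mul_assoc, norm_mul, HeckeCharacter.norm_valueAtUniformizer_mul_cpow hu]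
  have h0 : 0 ≤ (v.1.residueCard : ℝ) ^ (-s.re) := Real.rpow_nonneg (Nat.cast_nonneg _) _
  calc ‖ε v.1‖ * (v.1.residueCard : ℝ) ^ (-s.re) ≤ 1 * (v.1.residueCard : ℝ) ^ (-s.re) := by
        gcongr; exact hε _
    _ = _ := one_mul _

/-- The twisted Euler factors `(1 - ε_v ψ(ϖ_v) q_v^{-s})⁻¹` are multipliable for `Re s > 1`.
[cite: NeukirchANT1999, Ch. VII Prop. (8.1)] -/
theorem multipliable_twistedEulerFactor {ψ : HeckeCharacter K} (hu : ψ.IsUnitary)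
    (S : Set (HeightOneSpectrum (𝓞 K))) {ε : HeightOneSpectrum (𝓞 K) → ℂ} (hε : ∀ v, ‖ε v‖ ≤ 1)
    {s : ℂ} (hs : 1 < s.re) :
    Multipliable fun v : {v : HeightOneSpectrum (𝓞 K) // v ∉ S} =>
      (1 - ε v.1 * ψ.valueAtUniformizer v.1 * ((v.1.residueCard : ℂ) ^ (-s)))⁻¹ :=
  multipliable_inv_one_sub_of_summable_norm (summable_norm_twistedEulerDatum hu S hε hs)

/-- The twisted Euler data have norm `< 1` for `Re s > 0`, so the factors are finite and non-zero.
[folklore] -/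
theorem one_sub_twistedEulerDatum_ne_zero {ψ : HeckeCharacter K} (hu : ψ.IsUnitary)
    {ε : HeightOneSpectrum (𝓞 K) → ℂ} (hε : ∀ v, ‖ε v‖ ≤ 1) (v : HeightOneSpectrum (𝓞 K))
    {s : ℂ} (hs : 0 < s.re) :
    1 - ε v * ψ.valueAtUniformizer v * ((v.residueCard : ℂ) ^ (-s)) ≠ 0 := by
  intro h
  have h1 : ‖ε v * ψ.valueAtUniformizer v * ((v.residueCard : ℂ) ^ (-s))‖ = 1 := by
    rw [sub_eq_zero] at h
    rw [← h, norm_one]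
  rw [mul_assoc, norm_mul, HeckeCharacter.norm_valueAtUniformizer_mul_cpow hu] at h1
  have hq1 : (1 : ℝ) < v.residueCard := by exact_mod_cast v.one_lt_residueCard
  have hlt : (v.residueCard : ℝ) ^ (-s.re) < 1 := Real.rpow_lt_one_of_one_lt_of_neg hq1 (by linarith)
  have h0 : 0 ≤ (v.residueCard : ℝ) ^ (-s.re) := Real.rpow_nonneg (Nat.cast_nonneg _) _
  have : ‖ε v‖ * (v.residueCard : ℝ) ^ (-s.re) < 1 :=
    calc ‖ε v‖ * (v.residueCard : ℝ) ^ (-s.re) ≤ 1 * (v.residueCard : ℝ) ^ (-s.re) := by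
          gcongr; exact hε _
      _ < 1 := by rw [one_mul]; exact hlt
  linarith

/-- **Non-vanishing of the twisted partial Euler product on `Re s > 1`** (absolutely convergent
product of non-zero factors, Neukirch VII (8.1)). [cite: NeukirchANT1999, Ch. VII Prop. (8.1)] -/
theorem tprod_twistedEulerFactor_ne_zero {ψ : HeckeCharacter K} (hu : ψ.IsUnitary)
    (S : Set (HeightOneSpectrum (𝓞 K))) {ε : HeightOneSpectrum (𝓞 K) → ℂ} (hε : ∀ v, ‖ε v‖ ≤ 1)
    {s : ℂ} (hs : 1 < s.re) :
    ∏' v : {v : HeightOneSpectrum (𝓞 K) // v ∉ S},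
      (1 - ε v.1 * ψ.valueAtUniformizer v.1 * ((v.1.residueCard : ℂ) ^ (-s)))⁻¹ ≠ 0 := by
  set a : {v : HeightOneSpectrum (𝓞 K) // v ∉ S} → ℂ := fun v =>
    ε v.1 * ψ.valueAtUniformizer v.1 * ((v.1.residueCard : ℂ) ^ (-s)) with ha
  have hsum : Summable fun v => ‖(1 - a v)⁻¹ - 1‖ :=
    summable_norm_inv_sub_one (summable_norm_twistedEulerDatum hu S hε hs) fun v => by
      rw [ha]; simp
  have hne : ∀ v, 1 + ((1 - a v)⁻¹ - 1) ≠ 0 := fun v => by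
    rw [add_sub_cancel]
    exact inv_ne_zero (one_sub_twistedEulerDatum_ne_zero hu hε v.1 (by linarith))
  have := tprod_one_add_ne_zero_of_summable hne hsum
  simp only [add_sub_cancel] at this
  exact this

/-- The finite Euler factor `s ↦ 1 - q_v^{-s}` is entire. [folklore] -/
theorem differentiable_one_sub_residueCard_cpow_neg (v : HeightOneSpectrum (𝓞 K)) :
    Differentiable ℂ fun s : ℂ => 1 - ((v.residueCard : ℂ) ^ (-s)) := by
  have hq : (v.residueCard : ℂ) ≠ 0 :=
    Nat.cast_ne_zero.2 (ne_of_gt (lt_trans zero_lt_one v.one_lt_residueCard))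
  exact (differentiable_const _).sub (differentiable_id.neg.const_cpow (Or.inl hq))

/-- **Hecke–Tate continuation of a shifted partial `L`-function near `s = 1`.** Let `ψ` be a
unitary Hecke character of `K` trivial on `A_G`, unramified off the finite `T`, and `τ ∈ iℝ`. Then
`L^T(s + τ, ψ)` has, near `{Re s ≥ 1}`, the shape required by `GrbacShahidi2015_partialAsaiL_at_one`:
there are `k ≤ 1` (`k = 1` exactly when `ψ = 1` and `τ = 0`), `δ > 0` and `G` holomorphic on
`{1 < Re s} ∪ B(1, δ)` with `G(s) = (s - 1)^k L^T(s + τ, ψ)` for `Re s > 1` and `G(1) ≠ 0`: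
for `ψ ≠ 1`, `L^T(s, ψ)` is entire and zero-free on `Re s = 1` (Hecke 1917, Landau;
`exists_entire_forall_ne_zero_eq_partialHeckeL`); for `ψ = 1`, `ζ_K^T` has a simple pole at `1`
with non-zero residue and no zero on `Re s ≥ 1` (Hecke, Landau 1903).
[cite: Iwasawa2019, Thm. 3.1 and Ch. 4 §4.2 Prop. 4.4] [cite: LandauMathAnn1903, Part II Einleitung p. 666] -/
theorem exists_continuation_partialHeckeL_shift (ψ : HeckeCharacter K) (hu : ψ.IsUnitary)
    (hA : ∀ t : ℝ≥0ˣ, ψ (posRealIdele K t) = 1) {T : Set (HeightOneSpectrum (𝓞 K))} (hT : T.Finite)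
    (hur : ∀ v ∉ T, ψ.IsUnramifiedAt v) {τ : ℂ} (hτ : τ.re = 0) :
    ∃ (k : ℕ) (δ : ℝ) (G : ℂ → ℂ), (k = if ψ = 1 ∧ τ = 0 then 1 else 0) ∧ 0 < δ ∧
      DifferentiableOn ℂ G ({s : ℂ | 1 < s.re} ∪ Metric.ball 1 δ) ∧
      (∀ s : ℂ, 1 < s.re → G s = (s - 1) ^ k * ∏' v : {v : HeightOneSpectrum (𝓞 K) // v ∉ T},
        (1 - ψ.valueAtUniformizer v.1 * ((v.1.residueCard : ℂ) ^ (-(s + τ))))⁻¹) ∧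
      G 1 ≠ 0 := by
  by_cases hψ : ψ = 1
  · subst hψ
    by_cases hτ0 : τ = 0
    · -- `ζ_K^T`: simple pole at `s = 1`
      subst hτ0
      refine ⟨1, 1, fun s => Function.update (fun s : ℂ => (s - 1) * LFunctions.dedekindZetaCont K s)
        1 ((_root_.NumberField.dedekindZeta_residue K : ℝ) : ℂ) s *
          ∏ v ∈ hT.toFinset, (1 - ((v.residueCard : ℂ) ^ (-s))), by simp, one_pos, ?_, ?_, ?_⟩
      · exact ((differentiable_update_sub_one_mul_dedekindZetaCont (K := K)).mul
          (Differentiable.fun_finsetProd fun v _ => differentiable_one_sub_residueCard_cpow_neg v)).differentiableOn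
      · intro s hs
        dsimp only
        have hs1 : s ≠ 1 := fun h => by rw [h, Complex.one_re] at hs; exact lt_irrefl _ hs
        rw [Function.update_of_ne hs1, pow_one, mul_assoc,
          ← tprod_eulerFactor_one_eq_dedekindZetaCont_mul_prod hT hs]
        congr 1
        refine tprod_congr fun v => ?_
        rw [valueAtUniformizer_one_rankOne, one_mul, add_zero]
      · dsimp only
        rw [Function.update_self]
        refine mul_ne_zero ?_ (Finset.prod_ne_zero_iff.mpr fun v _ => ?_)
        · exact_mod_cast (_root_.NumberField.dedekindZeta_residue_pos K).ne'
        · exact one_sub_residueCard_cpow_neg_ne_zero v (by rw [Complex.one_re]; exact one_pos)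
    · -- `ζ_K^T(s + τ)`, `τ ≠ 0`: holomorphic off `s = 1 - τ`, which is off `{1 < Re s} ∪ B(1, ‖τ‖)`
      have hτpos : 0 < ‖τ‖ := norm_pos_iff.mpr hτ0
      refine ⟨0, ‖τ‖, fun s => LFunctions.dedekindZetaCont K (s + τ) *
          ∏ v ∈ hT.toFinset, (1 - ((v.residueCard : ℂ) ^ (-(s + τ)))), by simp [hτ0], hτpos, ?_, ?_, ?_⟩
      · have hζ : DifferentiableOn ℂ (fun s => LFunctions.dedekindZetaCont K (s + τ))
            ({s : ℂ | 1 < s.re} ∪ Metric.ball 1 ‖τ‖) := by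
          refine (LFunctions.NumberField.isDedekindZetaContinuation_dedekindZetaCont_holds K).differentiableOn.comp
            ((differentiableOn_id.add (differentiableOn_const _))) fun s hs => ?_
          simp only [Set.mem_compl_iff, Set.mem_singleton_iff]
          intro h1
          have hsτ : s = 1 - τ := eq_sub_of_add_eq h1
          rcases hs with hs | hs
          · simp only [Set.mem_setOf_eq, hsτ, Complex.sub_re, Complex.one_re, hτ, sub_zero] at hs
            exact lt_irrefl _ hs
          · rw [Metric.mem_ball, hsτ, dist_eq_norm, sub_sub_cancel_left, norm_neg] at hs
            exact lt_irrefl _ hs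
        have hP : Differentiable ℂ fun s : ℂ => ∏ v ∈ hT.toFinset, (1 - ((v.residueCard : ℂ) ^ (-(s + τ)))) :=
          Differentiable.fun_finsetProd fun v _ =>
            (differentiable_one_sub_residueCard_cpow_neg v).comp (differentiable_id.add (differentiable_const τ))
        exact hζ.mul hP.differentiableOn
      · intro s hs
        dsimp only
        have hs' : 1 < (s + τ).re := by rw [Complex.add_re, hτ, add_zero]; exact hs
        rw [pow_zero, one_mul, ← tprod_eulerFactor_one_eq_dedekindZetaCont_mul_prod hT hs']
        refine tprod_congr fun v => ?_
        rw [valueAtUniformizer_one_rankOne, one_mul]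
      · have h1τ : (1 + τ).re = 1 := by rw [Complex.add_re, Complex.one_re, hτ, add_zero]
        refine mul_ne_zero ?_ (Finset.prod_ne_zero_iff.mpr fun v _ => ?_)
        · exact LFunctions.dedekindZetaCont_ne_zero_of_one_le_re_holds (K := K)
            (le_of_eq h1τ.symm) (fun h => hτ0 (by simpa using h))
        · exact one_sub_residueCard_cpow_neg_ne_zero v (by rw [h1τ]; exact one_pos)
  · -- `ψ ≠ 1`: entire, zero-free on `Re s = 1`
    obtain ⟨g, hg, hg0, hg_eq⟩ := exists_entire_forall_ne_zero_eq_partialHeckeL ψ hu hA hψ hT hur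
    refine ⟨0, 1, fun s => g (s + τ), by simp [hψ], one_pos, ?_, ?_, ?_⟩
    · exact (hg.comp (differentiable_id.add (differentiable_const _))).differentiableOn
    · intro s hs
      dsimp only
      have hs' : 1 < (s + τ).re := by rw [Complex.add_re, hτ, add_zero]; exact hs
      rw [pow_zero, one_mul, hg_eq _ hs']
    · exact hg0 _ (by rw [Complex.add_re, Complex.one_re, hτ, add_zero])

end HeckeAnalytic


/-! ### The rank-one dictionary: Satake parameters of a `GL₁` datum are values of its Hecke character -/

section GLOne

variable {E : Type} [Field E] [NumberField E] {hcpt : isCompact_glFiniteIntegralLevel 1 E}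

/-- **`χ_π` is unramified wherever `π` is** (a copy of
`AutomorphicRepData.isUnramifiedAt_heckeCharacter_glOne` of `ReciprocityGLnRankOneProofs`, whose import
closure is not wanted here): a `K(𝔫)`-fixed form with `v ∤ 𝔫` is fixed by the scalars `u ∈ 𝒪_vˣ`,
on which `χ_π` therefore is `1`. Tate (1950), §2.3; Borel–Jacquet 1979, 4.6. [cite: BorelJacquet1979, 4.6] -/
theorem AutomorphicRepData.isUnramifiedAt_heckeCharacter_glOne'
    (π : AutomorphicRepData (AutomorphyDatum.gl 1 E hcpt)) {χ : HeckeCharacter E}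
    (hχ : ∀ (g : (AdelicGroupData.gl 1 E).Adelic), ∀ φ ∈ π.W,
      rightTranslation (AdelicGroupData.gl 1 E) g φ -
        ((χ (Matrix.GeneralLinearGroup.det g) : ℂˣ) : ℂ) • φ ∈ π.W')
    {v : HeightOneSpectrum (𝓞 E)} {α : Multiset ℂ} (hα : π.HasSatakeParamAt v α) :
    χ.IsUnramifiedAt v := by
  obtain ⟨𝔫, ϖ, h𝔫, hv, -, -, φ, hφW, hφW', hfix, -⟩ := hα
  intro u
  set g : (AdelicGroupData.gl 1 E).Adelic := Matrix.GeneralLinearGroup.scalar (Fin 1)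
    (localUnits v (Units.map ((v.adicCompletionIntegers E).subtype : _ →* _) u)) with hg
  have hgmem : g ∈ principalCongruenceLevel 1 E 𝔫 :=
    scalar_localUnits_mem_of_isMaximalAt (isMaximalAt_principalCongruenceLevel 1 E v h𝔫 hv) u
  have h1 := hχ g φ hφW
  rw [hfix g hgmem, hg, det_generalLinearGroup_scalar_fin_one] at h1
  have h2 : φ - (1 : ℂ) • φ ∈ π.W' := by
    rw [one_smul, sub_self]
    exact π.W'.zero_mem
  have key := eq_of_sub_smul_mem_of_not_mem h2 h1 hφW'
  refine Units.ext ?_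
  rw [HeckeCharacter.localComponent_apply, Units.val_one]
  exact key.symm

/-- **Satake parameters of a `GL₁` datum are the values of its Hecke character at uniformizers**:
`α = {χ_π(ϖ_v)}` (`exists_eq_singleton_of_hasSatakeParamAt_glOne`, and independence of the
uniformizer at the unramified `v`). Borel–Jacquet 1979, 4.6; Tate (1950), §2.5. [cite: BorelJacquet1979, 4.6] -/
theorem AutomorphicRepData.eq_singleton_valueAtUniformizer_glOne
    (π : AutomorphicRepData (AutomorphyDatum.gl 1 E hcpt)) {χ : HeckeCharacter E}
    (hχ : ∀ (g : (AdelicGroupData.gl 1 E).Adelic), ∀ φ ∈ π.W,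
      rightTranslation (AdelicGroupData.gl 1 E) g φ -
        ((χ (Matrix.GeneralLinearGroup.det g) : ℂˣ) : ℂ) • φ ∈ π.W')
    {v : HeightOneSpectrum (𝓞 E)} {α : Multiset ℂ} (hα : π.HasSatakeParamAt v α) :
    α = {χ.valueAtUniformizer v} := by
  obtain ⟨ϖ, hϖ, rfl⟩ := π.exists_eq_singleton_of_hasSatakeParamAt_glOne hχ hα
  rw [← HeckeCharacter.localComponent_apply,
    HeckeCharacter.localComponent_eq_valueAtUniformizer (π.isUnramifiedAt_heckeCharacter_glOne' hχ hα) hϖ]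

/-- **`χ = χ₀ · ‖·‖^{s₁}` with `χ₀` trivial on `A_G`** ("we may twist by a power of the norm",
Grbac–Shahidi §2.A p. 190; Borel–Jacquet 5.7 in rank one): on `ℝ_{>0}` the character `χ` is
`r ↦ r^z` (`exists_cpow_eq_map_posRealIdele`), and `‖z(r)‖^{z/[E:ℚ]} = r^z`.
[cite: TateThesis1967, §4.3] -/
theorem _root_.Literature.NumberTheory.GaloisRepresentations.HeckeCharacter.exists_eq_mul_normTwist (χ : HeckeCharacter E) :
    ∃ (χ₀ ν : HeckeCharacter E) (s₁ : ℂ),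
      (∀ x : ideleGroup E, ((ν x : ℂˣ) : ℂ) = ((ideleNorm x : ℝ) : ℂ) ^ s₁) ∧ χ = χ₀ * ν ∧
      ∀ r : ℝ≥0ˣ, χ₀ (posRealIdele E r) = 1 := by
  obtain ⟨z, hz⟩ := χ.exists_cpow_eq_map_posRealIdele
  set d : ℕ := Module.finrank ℚ E with hd
  have hd0 : (d : ℂ) ≠ 0 := Nat.cast_ne_zero.mpr Module.finrank_pos.ne'
  obtain ⟨ν, hν⟩ := exists_heckeCharacter_ideleNorm_cpow E (z / d)
  refine ⟨χ * ν⁻¹, ν, z / d, hν, by rw [inv_mul_cancel_right], fun r => ?_⟩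
  have hr : (0 : ℝ) ≤ ((r : ℝ≥0) : ℝ) := NNReal.coe_nonneg _
  have hνr : ((ν (posRealIdele E r) : ℂˣ) : ℂ) = (((r : ℝ≥0) : ℝ) : ℂ) ^ z := by
    rw [hν, ← coe_ideleNorm, ideleNorm_posRealIdele_holds E r, NNReal.coe_pow, Complex.ofReal_pow,
      ← Complex.cpow_natCast, ← Complex.cpow_mul, mul_div_cancel₀ _ hd0]
    · rw [← Complex.ofReal_log hr, ← Complex.ofReal_natCast, ← Complex.ofReal_mul, Complex.ofReal_im]
      exact neg_lt_zero.mpr Real.pi_pos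
    · rw [← Complex.ofReal_log hr, ← Complex.ofReal_natCast, ← Complex.ofReal_mul, Complex.ofReal_im]
      exact Real.pi_pos.le
  refine Units.ext ?_
  rw [HeckeCharacter.mul_apply, HeckeCharacter.inv_apply, Units.val_mul, Units.val_inv_eq_inv_val, hνr,
    hz r, Units.val_one, mul_inv_cancel₀]
  exact fun h => (NNReal.coe_pos.mpr (pos_iff_ne_zero.mpr r.ne_zero)).ne'
    (Complex.ofReal_eq_zero.mp ((Complex.cpow_eq_zero_iff _ _).mp h).1)

end GLOne

/-! ### The theorem -/

section RankOne

variable {F E : Type} [Field F] [NumberField F] [Field E] [NumberField E] [Algebra F E]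

/-- For quadratic `E/F` with non-trivial automorphism `c`, the Galois norm of an idele is
`N y = y · (c • y)` (`Aut(E/F) = {1, c}`). [folklore] -/
theorem ideleGalNorm_eq_mul_smul (h2 : Module.finrank F E = 2) {c : E ≃ₐ[F] E} (hc : c ≠ 1)
    (y : ideleGroup E) :
    haveI : FiniteDimensional F E := Module.finite_of_finrank_eq_succ h2
    AdeleRing.ideleGalNorm F E y = y * c • y := by
  haveI : FiniteDimensional F E := Module.finite_of_finrank_eq_succ h2
  rw [AdeleRing.ideleGalNorm_apply]
  have huniv : (Finset.univ : Finset (E ≃ₐ[F] E)) = {1, c} := by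
    ext σ
    simp only [Finset.mem_univ, Finset.mem_insert, Finset.mem_singleton, true_iff]
    exact AlgEquiv.eq_one_or_eq_of_finrank_eq_two h2 hc σ
  rw [huniv, Finset.prod_pair (Ne.symm hc), one_smul]

/-- A sign has norm one in `ℂ`. [folklore] -/
theorem norm_intCast_units_le_one (θ : ℤˣ) : ‖(((θ : ℤ) : ℂ))‖ ≤ 1 := by
  rcases Int.units_eq_one_or θ with rfl | rfl <;> simp

/-- **Grbac–Shahidi 2015, Thm. 4.3 at `s = 1`, for `GL(1)`: the rank-one stratum of the named fact
`GrbacShahidi2015_partialAsaiL_at_one`, proved.** For a quadratic extension `E/F` of number fields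
with non-trivial automorphism `c`, a cuspidal automorphic representation datum `π` of `GL₁(𝔸_E)`
(Borel–Jacquet) which is unitary almost everywhere, an Asai datum `(S, A)` of `π` and a sign `η`:
(i) the partial Asai Euler product `∏_{v ∉ S} det(1 - As^η(t_v) q_v^{-s})⁻¹` is multipliable for
`Re s > 1`, and (ii) there are `k ≤ 1`, `δ > 0` and `G` holomorphic on `{1 < Re s} ∪ B(1, δ)` with
`G(s) = (s - 1)^k L^S(s, π, As^η)` for `Re s > 1` and `G(1) ≠ 0` — verbatim the conclusion of the
fact, with `σ₀ = 1`.

In rank one the Asai `L`-functions are Hecke `L`-functions and Thm. 4.3 is Hecke–Tate theory with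
Landau's non-vanishing on `Re s = 1` (all of it theorems of the tree): `π` acts through a Hecke
character `χ = χ₀ ‖·‖^{iτ/2}` of `E` (`AutomorphicRepData.exists_heckeCharacter_glOne`; `χ₀` trivial
on `A_G`, hence unitary, `HeckeCharacter.isUnitary_of_map_posRealIdele`; `τ ∈ iℝ` by unitarity
a.e.), its Satake parameters are `{χ(ϖ_w)}` and
`L^S(s, π, As⁺) = L_F^S(s + τ… , χ₀|_{𝕀_F})` factor by factor (`eval_asaiLocalPolynomial_rankOne`:
Flicker's unramified computation in rank one), while `L^{S_E}(s, π × π^c) = L_E^{S_E}(s + …, χ₀ · χ₀∘c)`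
(`eval_satakePairPolynomial_rankOne`); both are continued by Hecke's theorem
(`exists_continuation_partialHeckeL_shift`: entire and zero-free on `Re s = 1` for a non-trivial
character, `ζ^S` with its simple pole otherwise), and `L^S(s, π, As⁻)` is obtained as the quotient
`L^{S_E}(s, π × π^c) / L^S(s, π, As⁺)` through Mok's factorisation
(`IsAsaiDatum.partialPairL_smul_eq_partialAsaiL_mul`) — the order count of Grbac–Shahidi's proof
(p. 206, identity `(∗∗)`) in its simplest instance: `ord₁ As⁻ = ord₁(pair) - ord₁ As⁺ ∈ {0, -1}`
because `χ₀|_{𝕀_F} = 1` forces `χ₀ · χ₀∘c = χ₀ ∘ N_{E/F} = 1`.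
[cite: GrbacShahidi2015, Thm. 4.3 (1), (2)(a)-(b), §2.A p. 190 and proof p. 206]
[cite: Flicker1988, pp. 305–306] [cite: TateThesis1967, Thm. 4.4.1] [cite: Iwasawa2019, Ch. 4 §4.2 Prop. 4.4] -/
theorem GrbacShahidi2015_partialAsaiL_at_one_rank_one
    (F E : Type) [Field F] [NumberField F] [Field E] [NumberField E] [Algebra F E] (c : E ≃ₐ[F] E)
    (h2 : Module.finrank F E = 2) (hc : c ≠ 1) (hcpt : isCompact_glFiniteIntegralLevel 1 E)
    (π : CuspidalAutomorphicRepData 1 E hcpt)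
    (hu : ∀ᶠ w : HeightOneSpectrum (𝓞 E) in cofinite, ∀ α : Multiset ℂ,
      π.1.HasSatakeParamAt w α → ‖α.prod‖ = 1)
    (S : Set (HeightOneSpectrum (𝓞 F))) (A : SatakeFamily E) (η : ℤˣ) (hSA : π.1.IsAsaiDatum c S A) :
    ∃ σ₀ : ℝ, 1 ≤ σ₀ ∧
      (∀ s : ℂ, σ₀ < s.re →
        Multipliable fun v : {v : HeightOneSpectrum (𝓞 F) // v ∉ S} =>
          ((asaiLocalPolynomial c A η (placeAbove E v.1)).eval ((v.1.residueCard : ℂ) ^ (-s)))⁻¹) ∧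
      ∃ (k : ℕ) (δ : ℝ) (G : ℂ → ℂ), k ≤ 1 ∧ 0 < δ ∧
        DifferentiableOn ℂ G ({s : ℂ | 1 < s.re} ∪ Metric.ball 1 δ) ∧
        (∀ s : ℂ, σ₀ < s.re → G s = (s - 1) ^ k * partialAsaiL S c A η s) ∧ G 1 ≠ 0 := by
  haveI hquad : Algebra.IsQuadraticExtension F E := { finrank_eq_two' := h2 }
  haveI : FiniteDimensional F E := Module.finite_of_finrank_eq_succ h2
  /- Step 1: the Hecke character `χ` of `π`; Satake parameters above `v ∉ S` are `{χ(ϖ_w)}` -/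
  obtain ⟨χ, hχπ⟩ := π.1.exists_heckeCharacter_glOne
  have hAχ : ∀ w : HeightOneSpectrum (𝓞 E), w.under (𝓞 F) ∉ S →
      A w = {χ.valueAtUniformizer w} ∧ χ.IsUnramifiedAt w := fun w hw =>
    ⟨π.1.eq_singleton_valueAtUniformizer_glOne hχπ (hSA.hasSatakeParamAt hw),
      π.1.isUnramifiedAt_heckeCharacter_glOne' hχπ (hSA.hasSatakeParamAt hw)⟩
  /- Step 2: `χ = χ₀ ‖·‖^{s₁}`, `χ₀` trivial on `A_G` hence unitary -/
  obtain ⟨χ₀, ν, s₁, hν, hχ, hχ₀A⟩ := χ.exists_eq_mul_normTwist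
  have hχ₀u : χ₀.IsUnitary := HeckeCharacter.isUnitary_of_map_posRealIdele hχ₀A
  have hν' : ∀ x : ideleGroup E, ((ν⁻¹ x : ℂˣ) : ℂ) = ((ideleNorm x : ℝ) : ℂ) ^ (-s₁) :=
    HeckeCharacter.inv_apply_of_forall_apply_eq_cpow hν
  have hχ₀unr : ∀ w : HeightOneSpectrum (𝓞 E), χ.IsUnramifiedAt w → χ₀.IsUnramifiedAt w := by
    intro w hw
    have h0 : χ₀ = χ * ν⁻¹ := by rw [hχ, mul_inv_cancel_right]
    rw [h0]
    exact hw.mul (HeckeCharacter.IsNormTwist.isUnramifiedAt_holds ⟨-s₁, hν'⟩ w)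
  /- Step 3: unitarity almost everywhere forces `Re s₁ = 0` -/
  set SE : Set (HeightOneSpectrum (𝓞 E)) := {w | w.under (𝓞 F) ∈ S} with hSEdef
  have hSE : SE.Finite := finite_setOf_under_mem hSA.finite
  have hs₁ : s₁.re = 0 := by
    have hev : ∀ᶠ w : HeightOneSpectrum (𝓞 E) in cofinite, w.under (𝓞 F) ∉ S := by
      rw [Filter.eventually_cofinite]
      simpa using hSE
    haveI := infinite_heightOneSpectrum E
    obtain ⟨w, hw1, hw2⟩ := (hu.and hev).exists
    obtain ⟨hAw, -⟩ := hAχ w hw2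
    have h1 := hw1 (A w) (hSA.hasSatakeParamAt hw2)
    rw [hAw, Multiset.prod_singleton, hχ, HeckeCharacter.valueAtUniformizer_mul,
      HeckeCharacter.valueAtUniformizer_normTwist hν, norm_mul,
      HeckeCharacter.norm_valueAtUniformizer_of_isUnitary hχ₀u, one_mul,
      Complex.norm_natCast_cpow_of_pos (lt_trans zero_lt_one w.one_lt_residueCard), Complex.neg_re] at h1
    have hq1 : (1 : ℝ) < w.residueCard := by exact_mod_cast w.one_lt_residueCard
    have h2' := congrArg Real.log h1
    rw [Real.log_rpow (by linarith), Real.log_one, mul_eq_zero] at h2'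
    rcases h2' with h | h
    · linarith
    · exact absurd h (Real.log_pos hq1).ne'
  set τ : ℂ := 2 * s₁ with hτdef
  have hτ : τ.re = 0 := by simp [hτdef, hs₁]
  /- Step 4: the restriction `ψ₀ = χ₀|_{𝕀_F}` -/
  obtain ⟨ψ₀, hψ₀⟩ := χ₀.exists_restrict F
  have hψ₀u : ψ₀.IsUnitary := fun x => by rw [hψ₀]; exact hχ₀u _
  have hψ₀A : ∀ t : ℝ≥0ˣ, ψ₀ (posRealIdele F t) = 1 := fun t => by
    rw [hψ₀, AdeleRing.ideleBaseChange_posRealIdele]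
    exact hχ₀A t
  have hunrv : ∀ v ∉ S, ∀ w : HeightOneSpectrum (𝓞 E), w.under (𝓞 F) = v → χ₀.IsUnramifiedAt w :=
    fun v hv w hw => hχ₀unr w (hAχ w (by rw [hw]; exact hv)).2
  have hψ₀ur : ∀ v ∉ S, ψ₀.IsUnramifiedAt v := fun v hv =>
    HeckeCharacter.isUnramifiedAt_restrict hψ₀ _ (HeightOneSpectrum.mem_pair_placeAbove_iff h2 hc v)
      (hunrv v hv)
  /- Step 5: `Θ = χ₀ · (χ₀ ∘ c)`, the character of the pair `(π, π^c)` up to the shift -/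
  obtain ⟨χ₀c, hχ₀c⟩ := χ₀.exists_galConj c
  set Θ : HeckeCharacter E := χ₀ * χ₀c with hΘdef
  have hΘu : Θ.IsUnitary := hχ₀u.mul fun x => by rw [hχ₀c]; exact hχ₀u _
  have hΘA : ∀ t : ℝ≥0ˣ, Θ (posRealIdele E t) = 1 := fun t => by
    rw [hΘdef, HeckeCharacter.mul_apply, hχ₀c, smul_posRealIdele, hχ₀A, mul_one]
  have hΘur : ∀ w ∉ SE, Θ.IsUnramifiedAt w := by
    intro w hw
    have hw' : w.under (𝓞 F) ∉ S := hw
    have hcw : (c • w).under (𝓞 F) ∉ S := by rwa [HeightOneSpectrum.under_algEquiv_smul F E c w]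
    exact (hχ₀unr w (hAχ w hw').2).mul
      (HeckeCharacter.isUnramifiedAt_galConj hχ₀c (hχ₀unr _ (hAχ (c • w) hcw).2))
  have hΘψ : ψ₀ = 1 → Θ = 1 := by
    intro h1
    refine HeckeCharacter.ext fun y => ?_
    obtain ⟨x, hx⟩ := AdeleRing.ideleGalNorm_mem_range_ideleBaseChange F E y
    rw [ideleGalNorm_eq_mul_smul h2 hc] at hx
    rw [hΘdef, HeckeCharacter.mul_apply, hχ₀c, ← map_mul, ← hx, ← hψ₀, h1]
    rfl
  /- Step 6: the Euler factors of `As^η` and of the pair, place by place -/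
  set ε : ℤˣ → HeightOneSpectrum (𝓞 F) → ℂ := fun θ v =>
    if c • placeAbove E v = placeAbove E v then (((θ : ℤ) : ℂ)) else 1 with hεdef
  have hε : ∀ θ v, ‖ε θ v‖ ≤ 1 := fun θ v => by
    simp only [hεdef]
    split_ifs
    · exact norm_intCast_units_le_one θ
    · simp
  have hε1 : ∀ v, ε 1 v = 1 := fun v => by simp [hεdef]
  have hq : ∀ v : HeightOneSpectrum (𝓞 F), (v.residueCard : ℂ) ≠ 0 := fun v =>
    Nat.cast_ne_zero.mpr (ne_of_gt (lt_trans zero_lt_one v.one_lt_residueCard))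
  have hqE : ∀ w : HeightOneSpectrum (𝓞 E), (w.residueCard : ℂ) ≠ 0 := fun w =>
    Nat.cast_ne_zero.mpr (ne_of_gt (lt_trans zero_lt_one w.one_lt_residueCard))
  have hAsaiFactor : ∀ (θ : ℤˣ) (s : ℂ) (v : {v : HeightOneSpectrum (𝓞 F) // v ∉ S}),
      ((asaiLocalPolynomial c A θ (placeAbove E v.1)).eval ((v.1.residueCard : ℂ) ^ (-s)))⁻¹ =
        (1 - ε θ v.1 * ψ₀.valueAtUniformizer v.1 * ((v.1.residueCard : ℂ) ^ (-(s + τ))))⁻¹ := by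
    intro θ s v
    rw [eval_asaiLocalPolynomial_rankOne h2 hc hν hχ hψ₀ (fun w hw => (hAχ w (by rw [hw]; exact v.2)).1)
      (hunrv v.1 v.2) (fun w hw hcw => hSA.inertiaDeg_eq_two (by rw [hw]; exact v.2) hcw) θ,
      inv_inj, show -(s + τ) = -(2 * s₁) + -s by rw [hτdef]; ring, Complex.cpow_add _ _ (hq v.1)]
    simp only [hεdef]
    ring
  have hPairFactor : ∀ (s : ℂ) (w : {w : HeightOneSpectrum (𝓞 E) // w ∉ SE}),
      ((satakePairPolynomial (A w.1) (A (c • w.1))).eval ((w.1.residueCard : ℂ) ^ (-s)))⁻¹ =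
        (1 - (1 : ℂ) * Θ.valueAtUniformizer w.1 * ((w.1.residueCard : ℂ) ^ (-(s + τ))))⁻¹ := by
    intro s w
    have hw : w.1.under (𝓞 F) ∉ S := w.2
    have hcw : (c • w.1).under (𝓞 F) ∉ S := by rwa [HeightOneSpectrum.under_algEquiv_smul F E c w.1]
    rw [eval_satakePairPolynomial_rankOne (F := F) hν hχ hχ₀c (hAχ w.1 hw).1 (hAχ (c • w.1) hcw).1
      (hχ₀unr _ (hAχ (c • w.1) hcw).2), inv_inj,
      show -(s + τ) = -(2 * s₁) + -s by rw [hτdef]; ring, Complex.cpow_add _ _ (hqE w.1)]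
    ring
  -- the three partial `L`-functions as shifted Hecke Euler products (all `s`)
  have hLeq : ∀ (θ : ℤˣ) (s : ℂ), partialAsaiL S c A θ s =
      ∏' v : {v : HeightOneSpectrum (𝓞 F) // v ∉ S},
        (1 - ε θ v.1 * ψ₀.valueAtUniformizer v.1 * ((v.1.residueCard : ℂ) ^ (-(s + τ))))⁻¹ :=
    fun θ s => tprod_congr fun v => hAsaiFactor θ s v
  have hReq : ∀ s : ℂ, partialPairL SE A (fun w => A (c • w)) s =
      ∏' w : {w : HeightOneSpectrum (𝓞 E) // w ∉ SE},
        (1 - (1 : ℂ) * Θ.valueAtUniformizer w.1 * ((w.1.residueCard : ℂ) ^ (-(s + τ))))⁻¹ :=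
    fun s => tprod_congr fun w => hPairFactor s w
  -- multipliability on `Re s > 1` and non-vanishing of `L^S(s, π, As⁺)` there
  have hre : ∀ s : ℂ, 1 < s.re → 1 < (s + τ).re := fun s hs => by
    rw [Complex.add_re, hτ, add_zero]; exact hs
  have hmulA : ∀ (θ : ℤˣ) (s : ℂ), 1 < s.re →
      Multipliable fun v : {v : HeightOneSpectrum (𝓞 F) // v ∉ S} =>
        ((asaiLocalPolynomial c A θ (placeAbove E v.1)).eval ((v.1.residueCard : ℂ) ^ (-s)))⁻¹ := by
    intro θ s hs
    rw [show (fun v : {v : HeightOneSpectrum (𝓞 F) // v ∉ S} =>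
        ((asaiLocalPolynomial c A θ (placeAbove E v.1)).eval ((v.1.residueCard : ℂ) ^ (-s)))⁻¹) =
        fun v => (1 - ε θ v.1 * ψ₀.valueAtUniformizer v.1 * ((v.1.residueCard : ℂ) ^ (-(s + τ))))⁻¹
        from funext (hAsaiFactor θ s)]
    exact multipliable_twistedEulerFactor hψ₀u S (hε θ) (hre s hs)
  have hmulP : ∀ s : ℂ, 1 < s.re →
      Multipliable fun w : {w : HeightOneSpectrum (𝓞 E) // w.under (𝓞 F) ∉ S} =>
        ((satakePairPolynomial (A w.1) (A (c • w.1))).eval ((w.1.residueCard : ℂ) ^ (-s)))⁻¹ := by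
    intro s hs
    rw [show (fun w : {w : HeightOneSpectrum (𝓞 E) // w.under (𝓞 F) ∉ S} =>
        ((satakePairPolynomial (A w.1) (A (c • w.1))).eval ((w.1.residueCard : ℂ) ^ (-s)))⁻¹) =
        fun w => (1 - (1 : ℂ) * Θ.valueAtUniformizer w.1 * ((w.1.residueCard : ℂ) ^ (-(s + τ))))⁻¹
        from funext (hPairFactor s)]
    exact multipliable_twistedEulerFactor (ε := fun _ => 1) hΘu SE (fun _ => by simp) (hre s hs)
  have hLne : ∀ s : ℂ, 1 < s.re → partialAsaiL S c A 1 s ≠ 0 := fun s hs => by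
    rw [hLeq 1 s]
    exact tprod_twistedEulerFactor_ne_zero hψ₀u S (hε 1) (hre s hs)
  -- Mok's factorisation on `Re s > 1`
  have hfac : ∀ s : ℂ, 1 < s.re →
      partialPairL SE A (fun w => A (c • w)) s = partialAsaiL S c A 1 s * partialAsaiL S c A (-1) s :=
    fun s hs => hSA.partialPairL_smul_eq_partialAsaiL_mul h2 hc (hmulP s hs) (hmulA 1 s hs) (hmulA (-1) s hs)
  /- Step 7: Hecke–Tate continuations of `L^S(s, π, As⁺)` and of `L^{S_E}(s, π × π^c)` -/
  obtain ⟨kp, δp, Gp, hkp, hδp, hGpd, hGpeq, hGp1⟩ :=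
    exists_continuation_partialHeckeL_shift ψ₀ hψ₀u hψ₀A hSA.finite hψ₀ur hτ
  obtain ⟨kR, δR, GR, hkR, hδR, hGRd, hGReq, hGR1⟩ :=
    exists_continuation_partialHeckeL_shift Θ hΘu hΘA hSE hΘur hτ
  have hGpL : ∀ s : ℂ, 1 < s.re → Gp s = (s - 1) ^ kp * partialAsaiL S c A 1 s := fun s hs => by
    rw [hGpeq s hs, hLeq 1 s]
    congr 1
    exact tprod_congr fun v => by rw [hε1, one_mul]
  have hGRL : ∀ s : ℂ, 1 < s.re → GR s = (s - 1) ^ kR * partialPairL SE A (fun w => A (c • w)) s :=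
    fun s hs => by
    rw [hGReq s hs, hReq s]
    congr 1
    exact tprod_congr fun w => by rw [one_mul]
  have hkp1 : kp ≤ 1 := by rw [hkp]; split_ifs <;> omega
  have hkR1 : kR ≤ 1 := by rw [hkR]; split_ifs <;> omega
  have hkpR : kp ≤ kR := by
    rw [hkp, hkR]
    by_cases h : ψ₀ = 1 ∧ τ = 0
    · rw [if_pos h, if_pos ⟨hΘψ h.1, h.2⟩]
    · rw [if_neg h]; exact Nat.zero_le _
  /- Step 8: the two signs -/
  rcases Int.units_eq_one_or η with rfl | rfl
  · exact ⟨1, le_rfl, fun s hs => hmulA 1 s hs, kp, δp, Gp, hkp1, hδp, hGpd, hGpL, hGp1⟩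
  · -- `As⁻ = (pair) / As⁺` on `{1 < Re s} ∪ B(1, δ)`, where `Gp ≠ 0`
    have hU : ({s : ℂ | 1 < s.re} ∪ Metric.ball 1 δp) ∈ 𝓝 (1 : ℂ) :=
      (isOpen_one_lt_re_union_ball δp).mem_nhds (Or.inr (Metric.mem_ball_self hδp))
    obtain ⟨δ₀, hδ₀, hGp0⟩ : ∃ δ₀ > 0, ∀ z : ℂ, dist z 1 < δ₀ → Gp z ≠ 0 :=
      Metric.eventually_nhds_iff.mp (((hGpd.continuousOn.continuousAt hU).eventually_ne hGp1))
    set δ : ℝ := min δp (min δR δ₀) with hδdef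
    have hδ : 0 < δ := lt_min hδp (lt_min hδR hδ₀)
    have hUp : {s : ℂ | 1 < s.re} ∪ Metric.ball (1 : ℂ) δ ⊆ {s : ℂ | 1 < s.re} ∪ Metric.ball 1 δp :=
      Set.union_subset_union_right _ (Metric.ball_subset_ball (min_le_left _ _))
    have hUR : {s : ℂ | 1 < s.re} ∪ Metric.ball (1 : ℂ) δ ⊆ {s : ℂ | 1 < s.re} ∪ Metric.ball 1 δR :=
      Set.union_subset_union_right _ (Metric.ball_subset_ball ((min_le_right _ _).trans (min_le_left _ _)))
    have hGpne : ∀ z ∈ {s : ℂ | 1 < s.re} ∪ Metric.ball (1 : ℂ) δ, Gp z ≠ 0 := by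
      rintro z (hz | hz)
      · have hz' : 1 < z.re := hz
        rw [hGpL z hz']
        have hz1 : z - 1 ≠ 0 := fun h => by
          rw [sub_eq_zero] at h; rw [h, Complex.one_re] at hz'; exact lt_irrefl _ hz'
        exact mul_ne_zero (pow_ne_zero _ hz1) (hLne z hz')
      · exact hGp0 z (lt_of_lt_of_le (Metric.mem_ball.mp hz) ((min_le_right _ _).trans (min_le_right _ _)))
    refine ⟨1, le_rfl, fun s hs => hmulA (-1) s hs, kR - kp, δ, fun s => GR s / Gp s, by omega, hδ,
      (hGRd.mono hUR).div (hGpd.mono hUp) hGpne, fun s hs => ?_, div_ne_zero hGR1 hGp1⟩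
    have hs1 : (1 : ℝ) < s.re := hs
    rw [div_eq_iff (hGpne s (Or.inl hs1)), hGRL s hs1, hGpL s hs1, hfac s hs1,
      show (s - 1) ^ kR = (s - 1) ^ (kR - kp) * (s - 1) ^ kp by rw [← pow_add, Nat.sub_add_cancel hkpR]]
    ring

/-- **The named fact reduced to ranks `N ≥ 2`.** `GrbacShahidi2015_partialAsaiL_at_one` follows from
its own restriction to cuspidal data of rank `N ≥ 2` — the rank-one stratum being the theorem
`GrbacShahidi2015_partialAsaiL_at_one_rank_one`. (What remains is Grbac–Shahidi's Thm. 4.3 proper: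
the Langlands–Shahidi theory of the Siegel Eisenstein series on `U(N, N)`, `N ≥ 2`.)
[cite: GrbacShahidi2015, Thm. 4.3] -/
theorem GrbacShahidi2015_partialAsaiL_at_one_of_two_le
    (h : ∀ (F E : Type) [Field F] [NumberField F] [Field E] [NumberField E] [Algebra F E]
      (c : E ≃ₐ[F] E), Module.finrank F E = 2 → c ≠ 1 →
      ∀ (N : ℕ) (hcpt : isCompact_glFiniteIntegralLevel N E) (π : CuspidalAutomorphicRepData N E hcpt),
        2 ≤ N →
        (∀ᶠ w : HeightOneSpectrum (𝓞 E) in cofinite, ∀ α : Multiset ℂ,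
          π.1.HasSatakeParamAt w α → ‖α.prod‖ = 1) →
        ∀ (S : Set (HeightOneSpectrum (𝓞 F))) (A : SatakeFamily E) (η : ℤˣ), π.1.IsAsaiDatum c S A →
          ∃ σ₀ : ℝ, 1 ≤ σ₀ ∧
            (∀ s : ℂ, σ₀ < s.re →
              Multipliable fun v : {v : HeightOneSpectrum (𝓞 F) // v ∉ S} =>
                ((asaiLocalPolynomial c A η (placeAbove E v.1)).eval ((v.1.residueCard : ℂ) ^ (-s)))⁻¹) ∧
            ∃ (k : ℕ) (δ : ℝ) (G : ℂ → ℂ), k ≤ 1 ∧ 0 < δ ∧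
              DifferentiableOn ℂ G ({s : ℂ | 1 < s.re} ∪ Metric.ball 1 δ) ∧
              (∀ s : ℂ, σ₀ < s.re → G s = (s - 1) ^ k * partialAsaiL S c A η s) ∧ G 1 ≠ 0) :
    GrbacShahidi2015_partialAsaiL_at_one := by
  intro F E _ _ _ _ _ c h2 hc N hcpt π hN hu S A η hSA
  rcases Nat.lt_or_ge N 2 with hN2 | hN2
  · obtain rfl : N = 1 := by omega
    exact GrbacShahidi2015_partialAsaiL_at_one_rank_one F E c h2 hc hcpt π hu S A η hSA
  · exact h F E c h2 hc N hcpt π hN2 hu S A η hSA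

end RankOne

end Literature.NumberTheory.Automorphic
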